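import Mathlib
import Summits.NavierStokesRegularity.NavierStokesRegularity.Theses.RootDecompLitSlice
import Summits.NavierStokesRegularity.NavierStokesRegularity.Theorems.RootDecompLitSliceNoDarkBallCompositionModuloStub
import Summits.NavierStokesRegularity.NavierStokesRegularity.Theorems.RootDecompLitSliceDarkBallSpreadsClosed
import HarnessLib

/-!
# Route RootDecompLitSlice — crux D `NoDarkBall` CLOSED (stmt-NavierStokesRegularity-29563)

`Summit.NavierStokesRegularity.NavierStokesRegularity.Theses.RootDecompLitSlice.NoDarkBall` follows BY
NAME from its registered aside D₁ `DarkBallSpreads` (stmt-NavierStokesRegularity-29566, now the kernel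
theorem `darkBallSpreads`, `Theorems/RootDecompLitSliceDarkBallSpreadsClosed.lean`) through the
census's landed composition `NoDarkBall.noDarkBall_of_darkBallSpreads`
(`Theorems/RootDecompLitSliceNoDarkBallCompositionModuloStub.lean`, p798859; the census also landed the
equivalence `NoDarkBall.noDarkBall_iff_darkBallSpreads`).

HONEST FRAMING (D-0179): crux D is an E-class piece — its residual toward the root statement is `S`
modulo a theorem — so this closure is DECORATIVE for the summit: it moves no tribunal verdict, books
no node of the residual decomposition, and proves nothing about Navier–Stokes regularity (rung 0). It
retires an open crux of the draft route RootDecompLitSlice honestly (proved, not dropped). Lands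
`--workitem stmt-NavierStokesRegularity-29563` (decomp-ns route-writer g16). [folklore]
-/

noncomputable section

-- the summit and its single sub-problem share the name (CONVENTIONS §1), as in every Theorems file
set_option linter.dupNamespace false

namespace Summit.NavierStokesRegularity.NavierStokesRegularity.Theorems

/-- **Crux D `NoDarkBall` of route RootDecompLitSlice, by name.** Decorative for the summit (D-0179).
[folklore] -/
theorem noDarkBall :
    Summit.NavierStokesRegularity.NavierStokesRegularity.Theses.RootDecompLitSlice.NoDarkBall :=
  NoDarkBall.noDarkBall_of_darkBallSpreads darkBallSpreads

end Summit.NavierStokesRegularity.NavierStokesRegularity.Theorems
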